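import Mathlib.Analysis.SpecialFunctions.Complex.LogDeriv
import Mathlib.Analysis.SpecialFunctions.Complex.Arg
import Mathlib.FieldTheory.IsAlgClosed.Basic
import Mathlib.Analysis.Complex.Polynomial.Basic
import Literature.Analysis.Complex.LogNormSqSubMeanValue
import HarnessLib

/-!
# An explicit conformal map of the disc onto a slit half-strip, and the resulting
# sub-mean-value inequality for entire functions bounded on a strip

Topic `Literature/Analysis/Complex`. For `r > 0`, `t > 0` put `A = e^{πt/r} - 1 > 0`,
`q(ξ) = (1+ξ)/(1-ξ)` (unit disc → right half-plane) and
`Ψ(ξ) = (r/π) Log(1 + A q(ξ)²)`. Then `Ψ` is holomorphic on the unit disc with values in the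
strip `{|Im z| < r}` (indeed in `{|Im z| < r} ∖ (-∞, 0]`), `Ψ(0) = t`, and its radial boundary
values run through the two lines `Im z = ± r` and (twice) the ray `(-∞, 0]`: writing
`q(e^{iθ}) = iσ`, `P* = 1 - Aσ²`, the radial limit of `Ψ(ρ e^{iθ})` is `(r/π) log P*` (a point of
the ray) if `P* > 0`, and `(r/π) log|P*| ± i r` (a point of the upper/lower line, the sign being
that of `sin θ`) if `P* < 0` — the principal logarithm jumps across its cut, which is why the
sub-mean-value inequality is taken in the radial-limit form
`Literature.Analysis.Complex.log_normSq_add_le_average_radialLimit`. This is the map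
`z ↦ w = ((1 - e^{πz/r})/(e^{πt/r} - 1))^{1/2}` of J. Bourgain, S. Dyatlov, *Spectral gaps without
the pressure condition*, Ann. of Math. 187 (2018), proof of Lemma 2.15, read from the disc side;
composing an entire `F`, bounded on the strip, with `Ψ` gives
`log(|F(t)|² + ε) ≤ (2π)⁻¹ ∫_0^{2π} log(|F(γ(θ))|² + ε) dθ` with the explicit boundary curve `γ`
(`log_normSq_add_le_average_slitStripBoundary`), an harmonic-measure-free substitute for
BD18 Lemma 2.12 on the simply connected domain `{|Im z| < r} ∖ (-∞, 0]`.
-/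

noncomputable section

namespace Literature.Analysis.Complex

open _root_.Complex Metric Real MeasureTheory Filter Set
open scoped Topology

/-- The Cayley variable `q(ξ) = (1 + ξ)/(1 - ξ)` (unit disc → right half-plane).
[cite: BourgainDyatlov2018, proof of Lemma 2.15] -/
def cayleyQ (ξ : ℂ) : ℂ := (1 + ξ) / (1 - ξ)

/-- The parameter `A = e^{πt/r} - 1` of the slit-half-strip map.
[cite: BourgainDyatlov2018, proof of Lemma 2.15] -/
def slitStripA (r t : ℝ) : ℝ := Real.exp (π * t / r) - 1

/-- The inner function `P(ξ) = 1 + A q(ξ)²` of the slit-half-strip map.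
[cite: BourgainDyatlov2018, proof of Lemma 2.15] -/
def slitStripP (r t : ℝ) (ξ : ℂ) : ℂ := 1 + (slitStripA r t : ℂ) * cayleyQ ξ ^ 2

/-- The map `Ψ(ξ) = (r/π) Log(1 + A q(ξ)²)` from the unit disc to the slit half-strip
`{|Im z| < r} ∖ (-∞, 0]`, with `Ψ(0) = t`. [cite: BourgainDyatlov2018, proof of Lemma 2.15] -/
def slitStripMap (r t : ℝ) (ξ : ℂ) : ℂ := (r / π : ℝ) * Complex.log (slitStripP r t ξ)

/-- `A = e^{πt/r} - 1 > 0` for `r, t > 0`. [folklore] -/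
theorem slitStripA_pos {r t : ℝ} (hr : 0 < r) (ht : 0 < t) : 0 < slitStripA r t := by
  unfold slitStripA
  have : 0 < π * t / r := by positivity
  linarith [Real.add_one_lt_exp this.ne']

/-- `Re q(ξ) = (1 - |ξ|²)/|1 - ξ|²`. [folklore] -/
theorem re_cayleyQ (ξ : ℂ) (hξ : ξ ≠ 1) :
    (cayleyQ ξ).re = (1 - ‖ξ‖ ^ 2) / Complex.normSq (1 - ξ) := by
  unfold cayleyQ
  have hne : (1 - ξ) ≠ 0 := sub_ne_zero.2 (Ne.symm hξ)
  rw [Complex.div_re, ← Complex.normSq_eq_norm_sq]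
  simp only [Complex.normSq_apply, Complex.add_re, Complex.one_re, Complex.sub_re, Complex.add_im,
    Complex.one_im, Complex.sub_im, zero_add, zero_sub]
  have hns : (1 - ξ.re) * (1 - ξ.re) + -ξ.im * -ξ.im ≠ 0 := by
    have := Complex.normSq_pos.2 hne
    rw [Complex.normSq_apply] at this
    simpa using this.ne'
  field_simp
  ring

/-- `Re q > 0` on the open unit disc. [folklore] -/
theorem re_cayleyQ_pos {ξ : ℂ} (hξ : ‖ξ‖ < 1) : 0 < (cayleyQ ξ).re := by
  have hξ1 : ξ ≠ 1 := by
    rintro rfl; simp at hξ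
  rw [re_cayleyQ ξ hξ1]
  apply div_pos
  · nlinarith [norm_nonneg ξ]
  · exact Complex.normSq_pos.2 (sub_ne_zero.2 (Ne.symm hξ1))

/-- On the unit circle `q` is purely imaginary. [folklore] -/
theorem re_cayleyQ_eq_zero {ξ : ℂ} (hξ : ‖ξ‖ = 1) (hξ1 : ξ ≠ 1) : (cayleyQ ξ).re = 0 := by
  rw [re_cayleyQ ξ hξ1, hξ]; simp

/-- `1 + A q²` lies in the slit plane when `Re q > 0` and `A > 0`; more precisely it is not a
real number `≤ 1`. [folklore] -/
theorem one_add_mul_sq_mem_slitPlane {A : ℝ} (hA : 0 < A) {q : ℂ} (hq : 0 < q.re) :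
    (1 + (A : ℂ) * q ^ 2) ∈ Complex.slitPlane := by
  rw [Complex.mem_slitPlane_iff]
  by_cases hy : q.im = 0
  · left
    have : (1 + (A : ℂ) * q ^ 2).re = 1 + A * (q.re ^ 2 - q.im ^ 2) := by
      simp only [sq, Complex.add_re, Complex.one_re, Complex.mul_re, Complex.mul_im, Complex.ofReal_re,
        Complex.ofReal_im, zero_mul, sub_zero]
    rw [this, hy]
    nlinarith [sq_nonneg q.re]
  · right
    have : (1 + (A : ℂ) * q ^ 2).im = A * (2 * q.re * q.im) := by
      simp only [sq, Complex.add_im, Complex.one_im, Complex.mul_im, Complex.mul_re, Complex.ofReal_re,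
        Complex.ofReal_im, zero_mul, zero_add, add_zero]; ring
    rw [this]
    exact mul_ne_zero hA.ne' (mul_ne_zero (mul_ne_zero two_ne_zero hq.ne') hy)

/-- If `1 + A q²` is real (`Re q > 0`, `A > 0`) then it is `> 1`. [folklore] -/
theorem one_lt_re_of_im_eq_zero {A : ℝ} (hA : 0 < A) {q : ℂ} (hq : 0 < q.re)
    (him : (1 + (A : ℂ) * q ^ 2).im = 0) : 1 < (1 + (A : ℂ) * q ^ 2).re := by
  have h1 : (1 + (A : ℂ) * q ^ 2).im = A * (2 * q.re * q.im) := by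
    simp only [sq, Complex.add_im, Complex.one_im, Complex.mul_im, Complex.mul_re, Complex.ofReal_re,
      Complex.ofReal_im, zero_mul, zero_add, add_zero]; ring
  rw [h1] at him
  have hy : q.im = 0 := by
    rcases mul_eq_zero.1 him with h | h
    · exact absurd h hA.ne'
    · rcases mul_eq_zero.1 h with h | h
      · rcases mul_eq_zero.1 h with h | h
        · norm_num at h
        · exact absurd h hq.ne'
      · exact h
  have : (1 + (A : ℂ) * q ^ 2).re = 1 + A * (q.re ^ 2 - q.im ^ 2) := by
    simp only [sq, Complex.add_re, Complex.one_re, Complex.mul_re, Complex.mul_im, Complex.ofReal_re,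
      Complex.ofReal_im, zero_mul, sub_zero]
  rw [this, hy]
  nlinarith [mul_pos hA (pow_pos hq 2)]

/-- `P` maps the disc into the slit plane. [folklore] -/
theorem slitStripP_mem_slitPlane {r t : ℝ} (hr : 0 < r) (ht : 0 < t) {ξ : ℂ} (hξ : ‖ξ‖ < 1) :
    slitStripP r t ξ ∈ Complex.slitPlane :=
  one_add_mul_sq_mem_slitPlane (slitStripA_pos hr ht) (re_cayleyQ_pos hξ)

/-- `q` is holomorphic away from `ξ = 1`. [folklore] -/
theorem differentiableAt_cayleyQ {ξ : ℂ} (hξ : ξ ≠ 1) : DifferentiableAt ℂ cayleyQ ξ := by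
  unfold cayleyQ
  apply DifferentiableAt.div
  · fun_prop
  · fun_prop
  · exact sub_ne_zero.2 (Ne.symm hξ)

/-- `Ψ` is holomorphic on the open unit disc. [cite: BourgainDyatlov2018, proof of Lemma 2.15] -/
theorem differentiableAt_slitStripMap {r t : ℝ} (hr : 0 < r) (ht : 0 < t) {ξ : ℂ}
    (hξ : ‖ξ‖ < 1) : DifferentiableAt ℂ (slitStripMap r t) ξ := by
  have hξ1 : ξ ≠ 1 := by rintro rfl; simp at hξ
  unfold slitStripMap
  apply DifferentiableAt.mul (differentiableAt_const _)
  have hP : DifferentiableAt ℂ (slitStripP r t) ξ := by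
    unfold slitStripP
    exact (differentiableAt_const _).add
      ((differentiableAt_const _).mul ((differentiableAt_cayleyQ hξ1).pow 2))
  exact (Complex.hasDerivAt_log (slitStripP_mem_slitPlane hr ht hξ)).differentiableAt.comp ξ hP

/-- `Ψ` is holomorphic on `ball 0 1`. [cite: BourgainDyatlov2018, proof of Lemma 2.15] -/
theorem differentiableOn_slitStripMap {r t : ℝ} (hr : 0 < r) (ht : 0 < t) :
    DifferentiableOn ℂ (slitStripMap r t) (ball 0 1) := fun ξ hξ =>
  (differentiableAt_slitStripMap hr ht (by simpa using hξ)).differentiableWithinAt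

/-- `Im Ψ(ξ) = (r/π) arg P(ξ)`. [folklore] -/
theorem im_slitStripMap (r t : ℝ) (ξ : ℂ) :
    (slitStripMap r t ξ).im = r / π * Complex.arg (slitStripP r t ξ) := by
  simp only [slitStripMap, Complex.mul_im, Complex.ofReal_re, Complex.ofReal_im, zero_mul, add_zero,
    Complex.log_im]

/-- `Ψ` maps the disc into the open strip `{|Im z| < r}`. [cite: BourgainDyatlov2018, proof of
Lemma 2.15] -/
theorem abs_im_slitStripMap_lt {r t : ℝ} (hr : 0 < r) (ht : 0 < t) {ξ : ℂ} (hξ : ‖ξ‖ < 1) :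
    |(slitStripMap r t ξ).im| < r := by
  rw [im_slitStripMap, abs_mul, abs_of_pos (by positivity : 0 < r / π)]
  have hmem := slitStripP_mem_slitPlane hr ht hξ
  rw [Complex.mem_slitPlane_iff_arg] at hmem
  have h1 : Complex.arg (slitStripP r t ξ) < π :=
    lt_of_le_of_ne (Complex.arg_le_pi _) hmem.1
  have h2 : -π < Complex.arg (slitStripP r t ξ) := Complex.neg_pi_lt_arg _
  have h3 : |Complex.arg (slitStripP r t ξ)| < π := abs_lt.2 ⟨h2, h1⟩
  calc r / π * |Complex.arg (slitStripP r t ξ)| < r / π * π :=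
        mul_lt_mul_of_pos_left h3 (by positivity)
    _ = r := by field_simp

/-- `Ψ(0) = t`. [cite: BourgainDyatlov2018, proof of Lemma 2.15] -/
theorem slitStripMap_zero {r t : ℝ} (hr : 0 < r) : slitStripMap r t 0 = t := by
  unfold slitStripMap slitStripP slitStripA cayleyQ
  have h1 : (1 : ℂ) + ((Real.exp (π * t / r) - 1 : ℝ) : ℂ) * ((1 + 0) / (1 - 0)) ^ 2 =
      ((Real.exp (π * t / r) : ℝ) : ℂ) := by
    push_cast; ring
  rw [h1, ← Complex.ofReal_log (Real.exp_pos _).le, Real.log_exp]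
  have hr' : (r : ℂ) ≠ 0 := by exact_mod_cast hr.ne'
  have hπ : (π : ℂ) ≠ 0 := by exact_mod_cast Real.pi_pos.ne'
  push_cast
  field_simp

/-! ### Boundary behaviour -/

/-- `Im q(ξ) = 2 Im ξ / |1 - ξ|²`. [folklore] -/
theorem im_cayleyQ (ξ : ℂ) (hξ : ξ ≠ 1) :
    (cayleyQ ξ).im = 2 * ξ.im / Complex.normSq (1 - ξ) := by
  unfold cayleyQ
  have hne : (1 - ξ) ≠ 0 := sub_ne_zero.2 (Ne.symm hξ)
  rw [Complex.div_im]
  simp only [Complex.normSq_apply, Complex.add_re, Complex.one_re, Complex.sub_re, Complex.add_im,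
    Complex.one_im, Complex.sub_im, zero_add, zero_sub]
  have hns : (1 - ξ.re) * (1 - ξ.re) + -ξ.im * -ξ.im ≠ 0 := by
    have := Complex.normSq_pos.2 hne
    rw [Complex.normSq_apply] at this
    simpa using this.ne'
  field_simp
  ring

/-- The boundary parameter `σ(θ) = Im q(e^{iθ})` (so that `q(e^{iθ}) = iσ(θ)`; in fact
`σ(θ) = cot(θ/2)`). [cite: BourgainDyatlov2018, proof of Lemma 2.15] -/
def bdrySigma (θ : ℝ) : ℝ := (cayleyQ (circleMap 0 1 θ)).im

/-- The real boundary value `P*(θ) = 1 - A σ(θ)²` of `P`. [cite: BourgainDyatlov2018, proof of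
Lemma 2.15] -/
def bdryP (r t θ : ℝ) : ℝ := 1 - slitStripA r t * bdrySigma θ ^ 2

/-- The boundary curve of the slit half-strip traced by the radial limits of `Ψ`: the point
`(r/π) log P*(θ)` of the ray `(-∞, 0]` when `P*(θ) > 0`, and the point
`(r/π) log|P*(θ)| ± ir` of the upper/lower line (sign of `sin θ`) when `P*(θ) < 0`.
[cite: BourgainDyatlov2018, proof of Lemma 2.15] -/
def slitStripBdry (r t θ : ℝ) : ℂ :=
  ((r / π * Real.log (bdryP r t θ) : ℝ) : ℂ) +
    (if 0 < bdryP r t θ then (0 : ℝ) else if 0 < Real.sin θ then r else -r : ℝ) * Complex.I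

/-- `|e^{iθ}| = 1`. [folklore] -/
theorem norm_circleMap_one (θ : ℝ) : ‖circleMap 0 1 θ‖ = 1 := by
  rw [norm_circleMap_zero, abs_one]

/-- `q(e^{iθ}) = iσ(θ)`. [folklore] -/
theorem cayleyQ_circleMap {θ : ℝ} (h1 : circleMap 0 1 θ ≠ 1) :
    cayleyQ (circleMap 0 1 θ) = (bdrySigma θ : ℂ) * Complex.I := by
  apply Complex.ext
  · rw [re_cayleyQ_eq_zero (norm_circleMap_one θ) h1]
    simp
  · simp [bdrySigma]

/-- `P(e^{iθ}) = P*(θ)`. [folklore] -/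
theorem slitStripP_circleMap {r t θ : ℝ} (h1 : circleMap 0 1 θ ≠ 1) :
    slitStripP r t (circleMap 0 1 θ) = (bdryP r t θ : ℂ) := by
  unfold slitStripP bdryP
  rw [cayleyQ_circleMap h1]
  push_cast
  rw [mul_pow, Complex.I_sq]
  ring

/-- `P(ρ e^{iθ}) → P*(θ)` as `ρ → 1⁻`. [folklore] -/
theorem tendsto_slitStripP_radial {r t θ : ℝ} (h1 : circleMap 0 1 θ ≠ 1) :
    Tendsto (fun ρ : ℝ => slitStripP r t (circleMap 0 ρ θ)) (𝓝[<] 1)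
      (𝓝 ((bdryP r t θ : ℝ) : ℂ)) := by
  rw [← slitStripP_circleMap h1]
  have hc : ContinuousAt (slitStripP r t) (circleMap 0 1 θ) := by
    unfold slitStripP
    exact (continuousAt_const.add
      (continuousAt_const.mul ((differentiableAt_cayleyQ h1).continuousAt.pow 2)))
  have hρ : Tendsto (fun ρ : ℝ => circleMap 0 ρ θ) (𝓝[<] 1) (𝓝 (circleMap 0 1 θ)) := by
    have : Continuous fun ρ : ℝ => circleMap 0 ρ θ := by unfold circleMap; fun_prop
    exact (this.tendsto 1).mono_left nhdsWithin_le_nhds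
  exact hc.tendsto.comp hρ

/-- The sign of `Im P(ρe^{iθ})` is that of `sin θ` (`0 < ρ < 1`). [folklore] -/
theorem im_slitStripP_circleMap {r t : ℝ} (hr : 0 < r) (ht : 0 < t) {ρ θ : ℝ} (hρ0 : 0 < ρ)
    (hρ1 : ρ < 1) :
    (0 < Real.sin θ → 0 < (slitStripP r t (circleMap 0 ρ θ)).im) ∧
      (Real.sin θ < 0 → (slitStripP r t (circleMap 0 ρ θ)).im < 0) := by
  set ξ := circleMap 0 ρ θ with hξ
  have hnorm : ‖ξ‖ < 1 := by rw [hξ, norm_circleMap_zero, abs_of_pos hρ0]; exact hρ1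
  have hξ1 : ξ ≠ 1 := by rintro h; rw [h] at hnorm; simp at hnorm
  have hre : 0 < (cayleyQ ξ).re := re_cayleyQ_pos hnorm
  have him : (cayleyQ ξ).im = 2 * ξ.im / Complex.normSq (1 - ξ) := im_cayleyQ ξ hξ1
  have hξim : ξ.im = ρ * Real.sin θ := by
    rw [hξ]; simp [circleMap, Complex.exp_ofReal_mul_I_im]
  have hns : 0 < Complex.normSq (1 - ξ) := Complex.normSq_pos.2 (sub_ne_zero.2 (Ne.symm hξ1))
  have hformula : (slitStripP r t ξ).im = slitStripA r t * (2 * (cayleyQ ξ).re * (cayleyQ ξ).im) := by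
    simp only [slitStripP, sq, Complex.add_im, Complex.one_im, Complex.mul_im, Complex.mul_re,
      Complex.ofReal_re, Complex.ofReal_im, zero_mul, zero_add, add_zero]; ring
  have hA := slitStripA_pos hr ht
  constructor
  · intro hs
    rw [hformula, him, hξim]
    apply mul_pos hA (mul_pos (mul_pos two_pos hre) (div_pos (by positivity) hns))
  · intro hs
    rw [hformula, him, hξim]
    apply mul_neg_of_pos_of_neg hA
    apply mul_neg_of_pos_of_neg (mul_pos two_pos hre)
    apply div_neg_of_neg_of_pos _ hns
    nlinarith

/-- **Radial limits of `Ψ`**: for `e^{iθ} ≠ 1` and `P*(θ) ≠ 0`,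
`Ψ(ρe^{iθ}) → γ(θ)` as `ρ → 1⁻`. [cite: BourgainDyatlov2018, proof of Lemma 2.15] -/
theorem tendsto_slitStripMap_radial {r t : ℝ} (hr : 0 < r) (ht : 0 < t) {θ : ℝ}
    (h1 : circleMap 0 1 θ ≠ 1) (hP : bdryP r t θ ≠ 0) :
    Tendsto (fun ρ : ℝ => slitStripMap r t (circleMap 0 ρ θ)) (𝓝[<] 1)
      (𝓝 (slitStripBdry r t θ)) := by
  have hPt := tendsto_slitStripP_radial (r := r) (t := t) h1
  unfold slitStripMap slitStripBdry
  rcases lt_or_gt_of_ne hP with hneg | hpos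
  · -- `P* < 0`: the lines; the side of the cut is the sign of `sin θ`
    have hsin : Real.sin θ ≠ 0 := by
      intro hs
      -- `sin θ = 0` forces `e^{iθ} = ±1`; `+1` is excluded and `-1` gives `σ = 0`, `P* = 1 > 0`
      have hcos : Real.cos θ = 1 ∨ Real.cos θ = -1 := by
        have := Real.sin_sq_add_cos_sq θ
        rw [hs] at this
        have h3 : (Real.cos θ - 1) * (Real.cos θ + 1) = 0 := by nlinarith
        rcases mul_eq_zero.1 h3 with h | h
        · exact Or.inl (by linarith)
        · exact Or.inr (by linarith)
      have hξ : circleMap 0 1 θ = (Real.cos θ : ℂ) := by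
        apply Complex.ext <;> simp [circleMap, Complex.exp_ofReal_mul_I_re,
          Complex.exp_ofReal_mul_I_im, hs, Complex.cos_ofReal_re, Complex.cos_ofReal_im]
      rcases hcos with hc | hc
      · exact h1 (by rw [hξ, hc]; simp)
      · have hσ : bdrySigma θ = 0 := by
          unfold bdrySigma cayleyQ; rw [hξ, hc]; simp
        unfold bdryP at hneg
        rw [hσ] at hneg
        norm_num at hneg
    have hre : ((bdryP r t θ : ℝ) : ℂ).re < 0 := by simpa using hneg
    have him : ((bdryP r t θ : ℝ) : ℂ).im = 0 := by simp
    rw [if_neg (not_lt.2 hneg.le)]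
    rcases lt_or_gt_of_ne hsin with hsn | hsp
    · -- lower line
      rw [if_neg (not_lt.2 hsn.le)]
      have hlog := Complex.tendsto_log_nhdsWithin_im_neg_of_re_neg_of_im_zero hre him
      have hW : Tendsto (fun ρ : ℝ => slitStripP r t (circleMap 0 ρ θ)) (𝓝[<] 1)
          (𝓝[{z : ℂ | z.im < 0}] ((bdryP r t θ : ℝ) : ℂ)) := by
        refine tendsto_nhdsWithin_iff.2 ⟨hPt, ?_⟩
        have hev : ∀ᶠ ρ : ℝ in 𝓝[<] 1, 0 < ρ ∧ ρ < 1 := by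
          have h1' : ∀ᶠ ρ : ℝ in 𝓝[<] 1, ρ < 1 := self_mem_nhdsWithin
          have h0' : ∀ᶠ ρ : ℝ in 𝓝[<] 1, 0 < ρ :=
            mem_nhdsWithin_of_mem_nhds (Ioi_mem_nhds zero_lt_one)
          exact h0'.and h1'
        filter_upwards [hev] with ρ hρ
        exact (im_slitStripP_circleMap hr ht hρ.1 hρ.2).2 hsn
      have := (hlog.comp hW).const_mul ((r / π : ℝ) : ℂ)
      refine this.congr' (Filter.Eventually.of_forall fun ρ => rfl) |>.trans ?_
      apply le_of_eq
      congr 1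
      rw [Complex.norm_real, Real.norm_eq_abs, Real.log_abs]
      push_cast
      have hπ : (π : ℂ) ≠ 0 := by exact_mod_cast Real.pi_pos.ne'
      field_simp
      ring
    · -- upper line
      rw [if_pos hsp]
      have hlog := (Complex.continuousWithinAt_log_of_re_neg_of_im_zero hre him).tendsto
      have hW : Tendsto (fun ρ : ℝ => slitStripP r t (circleMap 0 ρ θ)) (𝓝[<] 1)
          (𝓝[{z : ℂ | 0 ≤ z.im}] ((bdryP r t θ : ℝ) : ℂ)) := by
        refine tendsto_nhdsWithin_iff.2 ⟨hPt, ?_⟩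
        have hev : ∀ᶠ ρ : ℝ in 𝓝[<] 1, 0 < ρ ∧ ρ < 1 := by
          have h1' : ∀ᶠ ρ : ℝ in 𝓝[<] 1, ρ < 1 := self_mem_nhdsWithin
          have h0' : ∀ᶠ ρ : ℝ in 𝓝[<] 1, 0 < ρ :=
            mem_nhdsWithin_of_mem_nhds (Ioi_mem_nhds zero_lt_one)
          exact h0'.and h1'
        filter_upwards [hev] with ρ hρ
        exact ((im_slitStripP_circleMap hr ht hρ.1 hρ.2).1 hsp).le
      have := (hlog.comp hW).const_mul ((r / π : ℝ) : ℂ)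
      refine this.congr' (Filter.Eventually.of_forall fun ρ => rfl) |>.trans ?_
      apply le_of_eq
      congr 1
      rw [Complex.log, Complex.arg_ofReal_of_neg hneg, Complex.norm_real, Real.norm_eq_abs,
        Real.log_abs]
      push_cast
      have hπ : (π : ℂ) ≠ 0 := by exact_mod_cast Real.pi_pos.ne'
      field_simp
  · -- `P* > 0`: the ray
    rw [if_pos hpos]
    have hmem : ((bdryP r t θ : ℝ) : ℂ) ∈ Complex.slitPlane := by
      rw [Complex.mem_slitPlane_iff]; left; simpa using hpos
    have hlog := (continuousAt_clog hmem).tendsto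
    have := (hlog.comp hPt).const_mul ((r / π : ℝ) : ℂ)
    refine this.congr' (Filter.Eventually.of_forall fun ρ => rfl) |>.trans ?_
    apply le_of_eq
    congr 1
    rw [← Complex.ofReal_log hpos.le]
    push_cast
    ring

/-! ### The exceptional angles and the sub-mean-value inequality -/

/-- Inverting the Cayley variable: `ξ = (q - 1)/(q + 1)` for `ξ ≠ 1`. [folklore] -/
theorem eq_div_of_cayleyQ {ξ : ℂ} (hξ : ξ ≠ 1) :
    ξ = (cayleyQ ξ - 1) / (cayleyQ ξ + 1) := by
  have hne : (1 - ξ) ≠ 0 := sub_ne_zero.2 (Ne.symm hξ)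
  have hq1 : cayleyQ ξ + 1 ≠ 0 := by
    unfold cayleyQ
    rw [div_add_one hne]
    refine div_ne_zero ?_ hne
    norm_num
  rw [eq_div_iff hq1]
  unfold cayleyQ
  field_simp
  ring

/-- The set of exceptional boundary points (`ξ = 1` and the two zeros of `P` on the circle) is
finite. [folklore] -/
theorem finite_exceptional (r t : ℝ) :
    ({1} ∪ {ξ : ℂ | ξ ≠ 1 ∧ slitStripP r t ξ = 0}).Finite := by
  refine (Set.finite_singleton _).union ?_
  by_cases hA : slitStripA r t = 0
  · have : {ξ : ℂ | ξ ≠ 1 ∧ slitStripP r t ξ = 0} = ∅ := by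
      ext ξ
      simp [slitStripP, hA]
    rw [this]; exact Set.finite_empty
  · -- `A q² = -1` has at most the two solutions `q = ± w₀`
    obtain ⟨w₀, hw₀⟩ : ∃ w₀ : ℂ, w₀ ^ 2 = -1 / (slitStripA r t : ℂ) := by
      obtain ⟨w, hw⟩ := IsAlgClosed.exists_pow_nat_eq (-1 / (slitStripA r t : ℂ)) two_pos
      exact ⟨w, hw⟩
    have hsub : {ξ : ℂ | ξ ≠ 1 ∧ slitStripP r t ξ = 0} ⊆
        (fun w => (w - 1) / (w + 1)) '' {w₀, -w₀} := by
      intro ξ hξ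
      obtain ⟨hξ1, hP⟩ := hξ
      refine ⟨cayleyQ ξ, ?_, (eq_div_of_cayleyQ hξ1).symm⟩
      have hA' : (slitStripA r t : ℂ) ≠ 0 := by exact_mod_cast hA
      have hsq : cayleyQ ξ ^ 2 = w₀ ^ 2 := by
        rw [hw₀]
        unfold slitStripP at hP
        field_simp
        linear_combination hP
      rcases sq_eq_sq_iff_eq_or_eq_neg.1 hsq with h | h
      · exact Or.inl h
      · exact Or.inr h
    exact ((Set.finite_singleton _).insert _).image _ |>.subset hsub

/-- For a.e. `θ`, `e^{iθ} ≠ 1` and `P*(θ) ≠ 0`. [folklore] -/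
theorem ae_nonexceptional (r t : ℝ) :
    ∀ᵐ θ : ℝ ∂(volume : Measure ℝ), circleMap 0 1 θ ≠ 1 ∧ bdryP r t θ ≠ 0 := by
  have hnull : volume {θ : ℝ | circleMap 0 1 θ ∈ ({1} ∪ {ξ : ℂ | ξ ≠ 1 ∧ slitStripP r t ξ = 0})} = 0 :=
    (countable_circleMap_preimage (finite_exceptional r t) 0 one_ne_zero).measure_zero volume
  have hae : ∀ᵐ θ : ℝ ∂(volume : Measure ℝ),
      circleMap 0 1 θ ∉ ({1} ∪ {ξ : ℂ | ξ ≠ 1 ∧ slitStripP r t ξ = 0}) := by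
    rw [ae_iff]
    convert hnull using 2
    ext θ
    simp only [Set.mem_setOf_eq, not_not]
  filter_upwards [hae] with θ hθ
  simp only [Set.mem_union, Set.mem_singleton_iff, Set.mem_setOf_eq, not_or, not_and] at hθ
  refine ⟨hθ.1, fun hP => hθ.2 hθ.1 ?_⟩
  rw [slitStripP_circleMap hθ.1, hP]; simp

/-- **Sub-mean-value inequality on the slit half-strip, harmonic-measure free.** For an entire
`F` bounded on the open strip `{|Im z| < r}`, `r > 0`, `t > 0` and `ε > 0`:
`log(|F(t)|² + ε) ≤ (2π)⁻¹ ∫_0^{2π} log(|F(γ_{r,t}(θ))|² + ε) dθ`, where the explicit boundary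
curve `γ_{r,t} = slitStripBdry r t` runs through the lines `Im z = ±r` and (twice) the ray
`(-∞, 0]`. This replaces BD18 Lemma 2.12 (stated there with the harmonic measure of the doubly
connected slit strip) on the simply connected domain `{|Im z| < r} ∖ (-∞, 0]`.
[cite: BourgainDyatlov2018, Lemmas 2.12 and 2.15] -/
theorem log_normSq_add_le_average_slitStripBdry {F : ℂ → ℂ} (hF : Differentiable ℂ F)
    {B r t ε : ℝ} (hB : ∀ z : ℂ, |z.im| < r → ‖F z‖ ≤ B) (hr : 0 < r) (ht : 0 < t)
    (hε : 0 < ε) :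
    Real.log (‖F t‖ ^ 2 + ε) ≤
      (2 * π)⁻¹ * ∫ θ in (0 : ℝ)..2 * π, Real.log (‖F (slitStripBdry r t θ)‖ ^ 2 + ε) := by
  have hG : DifferentiableOn ℂ (fun ξ => F (slitStripMap r t ξ)) (ball 0 1) :=
    hF.comp_differentiableOn (differentiableOn_slitStripMap hr ht)
  have hM : ∀ z ∈ ball (0 : ℂ) 1, ‖F (slitStripMap r t z)‖ ≤ B := fun z hz =>
    hB _ (abs_im_slitStripMap_lt hr ht (by simpa using hz))
  have hrad : ∀ᵐ θ ∂(volume : Measure ℝ), Tendsto (fun ρ : ℝ => F (slitStripMap r t (circleMap 0 ρ θ)))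
      (𝓝[<] 1) (𝓝 (F (slitStripBdry r t θ))) := by
    filter_upwards [ae_nonexceptional r t] with θ hθ
    exact (hF.continuous.tendsto _).comp (tendsto_slitStripMap_radial hr ht hθ.1 hθ.2)
  have h := log_normSq_add_le_average_radialLimit hG hM hε hrad
  simpa only [slitStripMap_zero hr] using h

end Literature.Analysis.Complex
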